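import Mathlib.GroupTheory.Exponent
import Mathlib.Data.ZMod.Basic
import Mathlib.Algebra.IsPrimePow
import Mathlib.Analysis.SpecialFunctions.Pow.Real
import Mathlib.Analysis.SpecialFunctions.Log.Basic
import Mathlib.Analysis.MeanInequalities
import Literature.Computability.AlgebraicComplexity.GroupTheoreticMatMul
import Literature.Computability.AlgebraicComplexity.GroupAlgebraTensor
import Literature.Combinatorics.Additive.TripleProductProperty
import Literature.Combinatorics.Additive.SliceRankMethod
import Literature.Combinatorics.Additive.TricoloredSumFreeBound
import Literature.Barriers.MatrixMultiplication.UniversalMethodBarrier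
import HarnessLib

/-!
# Barrier: tricolored sum-free sets and slice rank — STPP constructions in abelian groups of bounded exponent cannot give `ω = 2` (Blasiak–Church–Cohn–Grochow–Naslund–Sawin–Umans 2017)

Topic `Literature/Barriers/MatrixMultiplication` (D-0021 barrier catalogue for the summit
`MatrixMultiplication`, `ω(ℂ) = 2`; this entry concerns the group-theoretic approach of
Cohn–Umans 2003 / Cohn–Kleinberg–Szegedy–Umans 2005 — route
`MatrixMultiplication/GroupTheoreticSTPP`, whose thesis `CThesis` asks for STPP constructions in
finite abelian groups beating `|H|` at exponent `(2+ε)/3`, and whose negative crux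
`CAbelianObstructionNeg` is Thm. B below WITHOUT the bounded-exponent hypothesis).

Source: J. Blasiak, T. Church, H. Cohn, J. A. Grochow, E. Naslund, W. F. Sawin, C. Umans, *On cap
sets and the group-theoretic approach to matrix multiplication*, Discrete Analysis 2017:3, 27 pp.,
arXiv:1605.06702 (numbering and pages below are those of the 27-page Discrete Analysis layout =
the current arXiv PDF, fetched and page-checked; the held store text `paper:arxiv-1605.06702` is
a 19-"page" extraction with the same theorem numbers: Thm. A / A′ p. 2, Thm. B p. 3, Def. 2.1 p. 3, Def. 2.2 p. 4, packing bounds and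
Def. 2.3 / Lemma 2.4 p. 5, Def. 3.1 p. 5, Def. 3.2 / Thm. 3.3 p. 6, Lemma 3.4 / Lemma 3.5 p. 8,
§4.1 (4.1)–(4.3) p. 11, Prop. 4.2 p. 12, Thm. 4.6 / Lemma 4.7 p. 15, Prop. 4.8 / Rem. 4.9 /
Thm. 4.10 p. 18, Prop. 4.12 / (4.10) / (4.11) / Prop. 4.13 p. 20, Thm. 4.14 / Prop. 4.15 p. 22,
proofs of Thm. A′ and A p. 22–23). Secondary: J. Blasiak, T. Church, H. Cohn, J. A. Grochow,
C. Umans, *Which groups are amenable to proving exponent two for matrix multiplication?*,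
arXiv:1712.02302 (2017), §2 (Def. 2.1, Thm. 2.8 = BCCGNSU Lemma 2.4, Thm. 2.9, Prop. 2.10,
Cor. 2.11; App. B Thm. B.8: cyclic groups have full slice rank).

## Catalogue entry

The D-0021 structured block (`technique_class / blocks / because / evasions_known / scope_caveats /
status`) is in the docstring of the catalogue declaration `TricoloredSumFreeBarrier` at the end of
this file (the gate indexes declaration docstrings, not module docstrings).

## What is already in the tree (imported, not restated)

* `IsSTPP` (CKSU Def. 5.1 = BCCGNSU Def. 2.2, additive one-clause form), the fundamental
  inequality `CohnKleinbergSzegedyUmans2005_5_5_abelian` (CKSU Thm. 5.5 = BCCGNSU (1.1), discharged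
  in `GroupTheoreticMatMulProofs.lean`) and the named fact
  `BlasiakChurchCohnGrochowNaslundSawinUmans2017_B` (**Thm. B**, effective reading) —
  `Literature/Computability/AlgebraicComplexity/GroupTheoreticMatMul.lean`;
* `TripleProductProperty`, `SimultaneousTPP`/`AddSimultaneousTPP` with the first packing bound
  `∑ |Aᵢ||Bᵢ| ≤ |H|` proved — `Literature/Combinatorics/Additive/TripleProductProperty.lean`;
* `HasSliceRankLE` (BCCGNSU (4.1)), Tao's Lemma 4.7 (`card_le_of_diagonal`, PROVED),
  `IsTricoloredSumFree` (Def. 3.1, functional form) with Prop. 4.8 (`card_le`, PROVED) —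
  `Literature/Combinatorics/Additive/SliceRankMethod.lean` (the provefact line that owns the
  discharge of Thm. B);
* **Thm. A PROVED in qualitative form** — `Literature.Combinatorics.Additive.exists_tricoloredSumFree_card_le`
  (`∀ ℓ, ∃ δ > 0`, exponent `H ≤ ℓ` ⇒ `|M| ≤ 3|H|^{1−δ}`, exactly the input of Thm. B; crude
  constants), with **Thm. 4.14 in counting form** (`IsTricoloredSumFree.card_le_of_addEquiv`),
  **Prop. 4.15** (`shiftedIndicator_eq_sum`), **Prop. 4.13** (`hasSliceRankLE_piZMod`) and a crude
  **Prop. 4.12** (`card_lowWeight_mul_pow_le`, `exists_theta`) —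
  `Literature/Combinatorics/Additive/TricoloredSumFreeBound.lean` (imported here);
* **Thm. 3.3 and Lemma 3.4 PROVED** — `AddSimultaneousTPP.exists_isBorderTricoloredSumFree`,
  `IsBorderTricoloredSumFree.exists_isTricoloredSumFree_pi`, with `IsBorderTricoloredSumFree`
  (Def. 3.2) — `Literature/Combinatorics/Additive/BorderTricoloredSumFree.lean` (not imported:
  landed after this file was written);
* `sliceRank` (Alman 2021 §2.6 = BCCGNSU (4.1)) — `UniversalMethodBarrier.lean`; `unitTensor`,
  `TensorRestrictsTo`, `subrank` — `AsymptoticSpectrum.lean`; the multiplication-table tensor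
  `groupTensor K G z x y = [xy = z]` = the structure tensor of `K[G]` (`structureTensor`,
  `groupTensor_eq_structureTensor`) — `GroupAlgebraTensor.lean` (bridged here by
  `mulGroupTensor_eq_groupTensor`).

## Content of this file

* `mulGroupTensor K G` / `addGroupTensor K H` — the diagonal-form group tensor
  `D_G(x,y,z) = [xyz = 1]` (BCCGNSU §4.2, before Prop. 4.8; additively `[x + y + z = 0]`, the form
  needed for `AddCommGroup`s and the one a tricolored sum-free set restricts to a diagonal), with the
  bridge `mulGroupTensor_eq_groupTensor` to the tree's `groupTensor` (`M_G`).
* General slice-rank API (`sliceRank_mem`, `sliceRank_le_of_tensorRestrictsTo`, the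
  `HasSliceRankLE ↔ sliceRank` bridge, `sliceRank_unitTensor`) — kept here for now; a review
  suggests a non-catalogue home next to `sliceRank` (librarian move welcome).
* PROVED: `tensorRestrictsTo_unitTensor_of_isTricoloredSumFree` (a tricolored sum-free set of
  size `m` gives `D_H ≥ ⟨m⟩`), `sliceRank_le_of_tensorRestrictsTo` (slice rank is monotone under
  restriction — BCCGU §2.3 / BCCGNSU proof of Prop. 4.8), the bridge
  `hasSliceRankLE_iff_sliceRank_le`, `sliceRank_unitTensor` (Lemma 4.7 in `sliceRank` form),
  `card_le_sliceRank_of_isTricoloredSumFree` (Prop. 4.8 in `sliceRank` form),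
  `le_subrank_of_isTricoloredSumFree` (`m ≤ Q(D_H)`).
* PROVED: **Lemma 2.4** (= BCCGU Thm. 2.8, "the packing bound is necessary"):
  `sum_rpow_le_of_packing` (the printed chain of inequalities, for nonnegative reals),
  `IsSTPP.packing` (all three packing bounds), `IsSTPP.sum_rpow_le_card_of_packing_defect`
  (effective form: a packing defect `∑|Aᵢ||Bᵢ| ≤ |H|^{1−3ε}` forces
  `∑ (|Aᵢ||Bᵢ||Cᵢ|)^{τ/3} ≤ |H|` at `τ = 2/(1−ε)`).
* Constants `bccgnsuDelta = log((2/3)2^{2/3})` (`> 0`, proved), `bccgnsuEpsilon = δ/2`, and the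
  rate function `bccgnsuJ` (eq. (4.10)).
* Named facts (statements only) — the EXPLICIT-CONSTANT forms: `BCCGNSU2017_thm414` (Thm. 4.14
  with `J(q)`), `BCCGNSU2017_thmA'` (Thm. A′ with `δ = log((2/3)2^{2/3})`), `BCCGNSU2017_thmA`
  (Thm. A with `ε = δ/2` and the "generated by elements of order `≤ m`" hypothesis), with the
  proved corollaries `BCCGNSU2017_thmA.of_exponent_le` and `BCCGNSU2017_thmA'.pow_form`
  (`|M| ≤ 3 (q e^{−δ})ⁿ`); the tree's PROVED qualitative Thm. A is
  `Literature.Combinatorics.Additive.exists_tricoloredSumFree_card_le` (cited in the block, not re-exported).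
* Catalogue entry `TricoloredSumFreeBarrier : Prop` (Thm. A ∧ Thm. A′ ∧ Thm. 4.14 ∧ Thm. B) with
  the D-0021 block and projections. The whole entry is PROVED in the sibling
  `TricoloredSumFreeBarrierProofs.lean` (`TricoloredSumFreeBarrier_holds`; Thm. B through
  `GroupTheoreticMatMulThmBProofs.lean`), and its EXPLICIT constants `ε_ℓ` (absent from print) are
  extracted in `TricoloredSumFreeBarrierEffective.lean` (barrier audit 2026-08-15, block fields
  `blocks` / `evasions_known` (d)–(e) / `scope_caveats` (c),(e),(f) / `status` below).

## Design choices and wording risks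

* Thm. A / A′ / 4.14 bound the SIZE of tricolored sum-free sets; the size is `Fintype.card ι` of
  the index type of `IsTricoloredSumFree s t u` (the three maps are injective, so this is `|M|`).
* "`H ≅ (ℤ/qℤ)ⁿ × G`" is `Nonempty (H ≃+ ((Fin n → ZMod q) × G))` with `q` a prime power
  (`IsPrimePow q`, so `q ≥ 2` and `log q > 0`); `|H|^{1−δ/log q}` uses the natural logarithm, as
  the printed proof (`J(q) ≤ J(2) = e^{−δ} = q^{−δ/log q}`) requires.
* Thm. A's hypothesis "generated by elements of order at most `m`" is
  `AddSubgroup.closure {h | addOrderOf h ≤ m} = ⊤`; for `m = 0` it forces `H` trivial and the bound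
  reads `|M| ≤ 3` (Lean's `ε/0 = 0`), true — no junk case is asserted beyond print.
* `J(s)` is `Real.sInf` over `x ∈ (0,1)` (nonnegative integrand, so no junk), divided by `s`.
* Thm. B itself is NOT restated: the tree's `BlasiakChurchCohnGrochowNaslundSawinUmans2017_B` is the
  catalogue's fourth conjunct (still a named fact: its discharge is the provefact line's job, whose
  DAG — Thm. A weak form, Thm. 4.14, Thm. 3.3, Lemma 3.4 — is already proved in
  `TricoloredSumFreeBound.lean` / `BorderTricoloredSumFree.lean`; Lemma 3.5 and the assembly of
  §3.2 remain). Thm. 3.3 / Lemma 3.4 / Lemma 3.5 are cited in the block, not restated here.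
* Lemma 2.4 is printed for "families" and "`|H|^{1−o(1)}`"; we prove the effective inequality its
  proof establishes (fixed `ε`, one construction), which is the form Thm. B's proof uses.
-/

noncomputable section

open scoped BigOperators
open Finset

namespace Literature.Barriers.MatrixMultiplication

universe u v

/-! ## The group tensor `D_G` and its restriction to a matching -/

section GroupTensor

variable (K : Type v) [CommSemiring K]

/-- The **diagonal-form group tensor** `D_G : G × G × G → K`, `D_G(x,y,z) = 1` if `x y z = 1` and `0`
otherwise (Blasiak–Church–Cohn–Grochow–Naslund–Sawin–Umans 2017, before Prop. 4.8, written there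
additively for abelian `H`: "the tensor encoding the group structure (corresponding to
multiplication in the group algebra `F H`)"). This is the form in which a tricolored sum-free set /
multiplicative matching restricts the tensor to a DIAGONAL (`sᵢ tⱼ u_k = 1 ⟺ i = j = k`), and the
form with an additive translation (`addGroupTensor`, needed for `AddCommGroup`s). The tree's
multiplication-table tensor `groupTensor K G z x y = [xy = z]` (= `M_G`, the structure tensor of
`K[G]`, `GroupAlgebraTensor.lean`) is the same tensor up to inverting and moving one coordinate:
`D_G(x,y,z) = M_G(z⁻¹; x, y)` (`mulGroupTensor_eq_groupTensor`); the two have the same slice rank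
(BCCGU 2017 §2.3 / Sawin 2018 Lemma 1.4; proved in `NilpotentGroupBarrier.lean`).
[cite: BlasiakChurchCohnGrochowNaslundSawinUmans2017, §4.2 (before Prop. 4.8)] -/
@[to_additive (dont_translate := K) addGroupTensor /-- The **group tensor** `D_H : H × H × H → K` of
an additive group, `D_H(x,y,z) = 1` if `x + y + z = 0` and `0` otherwise (Blasiak–Church–Cohn–
Grochow–Naslund–Sawin–Umans 2017, before Prop. 4.8: "the tensor encoding the group structure
(corresponding to multiplication in the group algebra `F H`)").
(Reference: BlasiakChurchCohnGrochowNaslundSawinUmans2017, §4.2, before Prop. 4.8.) -/]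
def mulGroupTensor (G : Type u) [Group G] [DecidableEq G] : G → G → G → K :=
  fun x y z => if x * y * z = 1 then 1 else 0

variable {K}

/-- Entries of the group tensor. [folklore] -/
@[to_additive (dont_translate := K) (attr := simp) addGroupTensor_apply /-- Entries of the additive
group tensor. [folklore] -/]
theorem mulGroupTensor_apply {G : Type u} [Group G] [DecidableEq G] (x y z : G) :
    mulGroupTensor K G x y z = if x * y * z = 1 then 1 else 0 := rfl

/-- **Bridge to the tree's multiplication-table tensor** (`groupTensor`, `GroupAlgebraTensor.lean`,
`groupTensor K G z x y = [xy = z]`): `D_G(x,y,z) = M_G(z⁻¹; x, y)`, i.e. `D_G` is `M_G` with the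
output coordinate inverted (and listed last). [folklore] -/
theorem mulGroupTensor_eq_groupTensor {G : Type u} [Group G] [DecidableEq G] (x y z : G) :
    mulGroupTensor K G x y z = Literature.Computability.AlgebraicComplexity.groupTensor K G z⁻¹ x y := by
  simp only [mulGroupTensor_apply, Literature.Computability.AlgebraicComplexity.groupTensor_apply, mul_eq_one_iff_eq_inv]

open Literature.Combinatorics.Additive in
/-- **A tricolored sum-free set of cardinality `|ι|` restricts the group tensor to a diagonal**
(the content of the proof of BCCGNSU Prop. 4.8: "`M ⊆ S × T × U` is a tricolored sum-free set if
and only if the restriction `D_H|_{S×T×U}` is a diagonal"): with the coordinate restrictions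
`A i a = [a = s i]`, `B j b = [b = t j]`, `C k c = [c = u k]` one gets `(A ⊗ B ⊗ C) D_H = ⟨m⟩`
after indexing `M` by `Fin m`, i.e. `D_H ≥ ⟨m⟩` in the restriction order (`TensorRestrictsTo`,
`unitTensor` of `AsymptoticSpectrum.lean`).
[cite: BlasiakChurchCohnGrochowNaslundSawinUmans2017, Prop. 4.8 (proof)] -/
theorem tensorRestrictsTo_unitTensor_of_isTricoloredSumFree {H : Type u} [AddCommGroup H]
    [Fintype H] [DecidableEq H] {m : ℕ} {s t u : Fin m → H} (h : IsTricoloredSumFree s t u) :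
    Literature.Computability.AlgebraicComplexity.TensorRestrictsTo (addGroupTensor K H) (Literature.Computability.AlgebraicComplexity.unitTensor K m) := by
  refine ⟨fun a' a => if a = s a' then 1 else 0, fun b' b => if b = t b' then 1 else 0,
    fun c' c => if c = u c' then 1 else 0, fun a' b' c' => ?_⟩
  rw [Finset.sum_eq_single (s a') (fun a _ ha => by simp [ha]) (by simp),
    Finset.sum_eq_single (t b') (fun b _ hb => by simp [hb]) (by simp),
    Finset.sum_eq_single (u c') (fun c _ hc => by simp [hc]) (by simp)]
  by_cases hd : a' = b' ∧ b' = c'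
  · simp [hd.1, hd.2, (h c' c' c').2 ⟨rfl, rfl⟩]
  · have hne : s a' + t b' + u c' ≠ 0 := fun h1 => hd ((h a' b' c').1 h1)
    simp [hd, hne]

end GroupTensor

/-! ## Slice rank: monotonicity under restriction, and Tao's diagonal lemma -/

section SliceRankMono

variable {K : Type v} [CommSemiring K]
variable {ι κ μ ι' κ' μ' : Type*}

/-- The defining set of `sliceRank t` is nonempty for a finite first index type (slice along every
`x`-coordinate), so the infimum is attained. [folklore] -/
theorem sliceRank_mem [Fintype ι] (t : ι → κ → μ → K) :
    ∃ kx ky kz : ℕ, kx + ky + kz = sliceRank t ∧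
    ∃ (α₁ : Fin kx → ι → K) (β₁ : Fin kx → κ → μ → K) (α₂ : Fin ky → κ → K)
      (β₂ : Fin ky → ι → μ → K) (α₃ : Fin kz → μ → K) (β₃ : Fin kz → ι → κ → K),
      t = fun a b c =>
        (∑ i, α₁ i a * β₁ i b c) + (∑ i, α₂ i b * β₂ i a c) + (∑ i, α₃ i c * β₃ i a b) := by
  classical
  set e := Fintype.equivFin ι
  have hne : {k : ℕ | ∃ kx ky kz : ℕ, kx + ky + kz = k ∧
      ∃ (α₁ : Fin kx → ι → K) (β₁ : Fin kx → κ → μ → K) (α₂ : Fin ky → κ → K)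
        (β₂ : Fin ky → ι → μ → K) (α₃ : Fin kz → μ → K) (β₃ : Fin kz → ι → κ → K),
        t = fun a b c =>
          (∑ i, α₁ i a * β₁ i b c) + (∑ i, α₂ i b * β₂ i a c) + (∑ i, α₃ i c * β₃ i a b)}.Nonempty := by
    refine ⟨Fintype.card ι + 0 + 0, Fintype.card ι, 0, 0, rfl,
      fun i a => if e a = i then 1 else 0, fun i b c => t (e.symm i) b c,
      Fin.elim0, Fin.elim0, Fin.elim0, Fin.elim0, ?_⟩
    funext a b c
    simp only [Finset.univ_eq_empty, Finset.sum_empty, add_zero]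
    rw [Finset.sum_eq_single (e a)]
    · simp
    · intro i _ hi
      simp [Ne.symm hi]
    · simp
  exact Nat.sInf_mem hne

/-- A slice decomposition of `t` pushes forward along linear maps `A, B, C`: the tensor
`(A ⊗ B ⊗ C) t` has a slice decomposition with the same numbers of slices. [folklore] -/
theorem sliceDecomposition_map [Fintype ι] [Fintype κ] [Fintype μ] {kx ky kz : ℕ}
    (α₁ : Fin kx → ι → K) (β₁ : Fin kx → κ → μ → K) (α₂ : Fin ky → κ → K)
    (β₂ : Fin ky → ι → μ → K) (α₃ : Fin kz → μ → K) (β₃ : Fin kz → ι → κ → K)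
    (A : ι' → ι → K) (B : κ' → κ → K) (C : μ' → μ → K) (a' : ι') (b' : κ') (c' : μ') :
    (∑ a, ∑ b, ∑ c, A a' a * B b' b * C c' c *
        ((∑ i, α₁ i a * β₁ i b c) + (∑ i, α₂ i b * β₂ i a c) + (∑ i, α₃ i c * β₃ i a b))) =
      (∑ i, (∑ a, A a' a * α₁ i a) * (∑ b, ∑ c, B b' b * C c' c * β₁ i b c)) +
      (∑ i, (∑ b, B b' b * α₂ i b) * (∑ a, ∑ c, A a' a * C c' c * β₂ i a c)) +
      (∑ i, (∑ c, C c' c * α₃ i c) * (∑ a, ∑ b, A a' a * B b' b * β₃ i a b)) := by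
  -- expand everything into sums over `(a, b, c, i)` of monomials and compare termwise
  have h1 : ∀ i : Fin kx, (∑ a, A a' a * α₁ i a) * (∑ b, ∑ c, B b' b * C c' c * β₁ i b c) =
      ∑ a, ∑ b, ∑ c, A a' a * B b' b * C c' c * (α₁ i a * β₁ i b c) := by
    intro i
    rw [Finset.sum_mul]
    simp_rw [Finset.mul_sum]
    refine Finset.sum_congr rfl fun a _ => Finset.sum_congr rfl fun b _ =>
      Finset.sum_congr rfl fun c _ => ?_
    ring
  have h2 : ∀ i : Fin ky, (∑ b, B b' b * α₂ i b) * (∑ a, ∑ c, A a' a * C c' c * β₂ i a c) =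
      ∑ a, ∑ b, ∑ c, A a' a * B b' b * C c' c * (α₂ i b * β₂ i a c) := by
    intro i
    rw [Finset.sum_mul]
    simp_rw [Finset.mul_sum]
    rw [Finset.sum_comm]
    refine Finset.sum_congr rfl fun a _ => Finset.sum_congr rfl fun b _ =>
      Finset.sum_congr rfl fun c _ => ?_
    ring
  have h3 : ∀ i : Fin kz, (∑ c, C c' c * α₃ i c) * (∑ a, ∑ b, A a' a * B b' b * β₃ i a b) =
      ∑ a, ∑ b, ∑ c, A a' a * B b' b * C c' c * (α₃ i c * β₃ i a b) := by
    intro i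
    rw [Finset.sum_mul]
    simp_rw [Finset.mul_sum]
    rw [Finset.sum_comm]
    refine Finset.sum_congr rfl fun a _ => ?_
    rw [Finset.sum_comm]
    refine Finset.sum_congr rfl fun b _ => Finset.sum_congr rfl fun c _ => ?_
    ring
  simp_rw [h1, h2, h3]
  rw [Finset.sum_comm (s := (Finset.univ : Finset (Fin kx))),
    Finset.sum_comm (s := (Finset.univ : Finset (Fin ky))),
    Finset.sum_comm (s := (Finset.univ : Finset (Fin kz))), ← Finset.sum_add_distrib,
    ← Finset.sum_add_distrib]
  refine Finset.sum_congr rfl fun a _ => ?_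
  rw [Finset.sum_comm (s := (Finset.univ : Finset (Fin kx))),
    Finset.sum_comm (s := (Finset.univ : Finset (Fin ky))),
    Finset.sum_comm (s := (Finset.univ : Finset (Fin kz))), ← Finset.sum_add_distrib,
    ← Finset.sum_add_distrib]
  refine Finset.sum_congr rfl fun b _ => ?_
  rw [Finset.sum_comm (s := (Finset.univ : Finset (Fin kx))),
    Finset.sum_comm (s := (Finset.univ : Finset (Fin ky))),
    Finset.sum_comm (s := (Finset.univ : Finset (Fin kz))), ← Finset.sum_add_distrib,
    ← Finset.sum_add_distrib]
  refine Finset.sum_congr rfl fun c _ => ?_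
  rw [mul_add, mul_add, Finset.mul_sum, Finset.mul_sum, Finset.mul_sum]

/-- **Slice rank is monotone under restriction**: if `t ≥ s` (`s = (A ⊗ B ⊗ C) t`) then
`slice-rank(s) ≤ slice-rank(t)` (Blasiak–Church–Cohn–Grochow–Umans 2017, §2.3: slice rank is
invariant under `GL × GL × GL`; the same one-line argument — push a slice decomposition forward —
gives monotonicity under arbitrary linear maps, cf. BCCGNSU 2017, proof of Prop. 4.8, for coordinate
restrictions). [cite: BlasiakChurchCohnGrochowNaslundSawinUmans2017, Prop. 4.8 (proof)] -/
theorem sliceRank_le_of_tensorRestrictsTo [Fintype ι] [Fintype κ] [Fintype μ]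
    {t : ι → κ → μ → K} {s : ι' → κ' → μ' → K}
    (h : Literature.Computability.AlgebraicComplexity.TensorRestrictsTo t s) : sliceRank s ≤ sliceRank t := by
  obtain ⟨kx, ky, kz, hk, α₁, β₁, α₂, β₂, α₃, β₃, ht⟩ := sliceRank_mem t
  obtain ⟨A, B, C, hs⟩ := h
  rw [← hk]
  refine sliceRank_le_of_eq (fun i a' => ∑ a, A a' a * α₁ i a)
    (fun i b' c' => ∑ b, ∑ c, B b' b * C c' c * β₁ i b c) (fun i b' => ∑ b, B b' b * α₂ i b)
    (fun i a' c' => ∑ a, ∑ c, A a' a * C c' c * β₂ i a c) (fun i c' => ∑ c, C c' c * α₃ i c)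
    (fun i a' b' => ∑ a, ∑ b, A a' a * B b' b * β₃ i a b) ?_
  funext a' b' c'
  rw [hs a' b' c', ← sliceDecomposition_map α₁ β₁ α₂ β₂ α₃ β₃ A B C a' b' c']
  simp_rw [ht]

end SliceRankMono

/-! ## Bridge: `HasSliceRankLE` (Combinatorics) versus `sliceRank` (this topic); Prop. 4.8 in slice-rank form -/

section Bridge

open Literature.Combinatorics.Additive

variable {K : Type v} [Field K]
variable {X Y Z : Type*}

/-- A `k`-slice decomposition bounds the slice rank: `HasSliceRankLE D k → sliceRank D ≤ k`.
[folklore] -/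
theorem _root_.Literature.Combinatorics.Additive.HasSliceRankLE.sliceRank_le {D : X → Y → Z → K} {k : ℕ}
    (h : HasSliceRankLE D k) : sliceRank D ≤ k := by
  obtain ⟨kx, ky, kz, hk, f₁, g₁, f₂, g₂, f₃, g₃, hD⟩ := h
  refine (sliceRank_le_of_eq f₁ g₁ f₂ g₂ f₃ g₃ ?_).trans hk
  funext x y z
  exact hD x y z

/-- The slice rank is attained by a slice decomposition (finite first index type). [folklore] -/
theorem hasSliceRankLE_sliceRank [Fintype X] (D : X → Y → Z → K) :
    HasSliceRankLE D (sliceRank D) := by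
  obtain ⟨kx, ky, kz, hk, f₁, g₁, f₂, g₂, f₃, g₃, hD⟩ := sliceRank_mem D
  exact ⟨kx, ky, kz, hk.le, f₁, g₁, f₂, g₂, f₃, g₃, fun x y z => by rw [hD]⟩

/-- `HasSliceRankLE D k ↔ sliceRank D ≤ k` (finite first index type): the two formalisations of
"slice rank at most `k`" in the tree agree. [folklore] -/
theorem hasSliceRankLE_iff_sliceRank_le [Fintype X] (D : X → Y → Z → K) (k : ℕ) :
    HasSliceRankLE D k ↔ sliceRank D ≤ k :=
  ⟨fun h => h.sliceRank_le, fun h => (hasSliceRankLE_sliceRank D).mono h⟩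

/-- **Tao's lemma in slice-rank form** (BCCGNSU 2017, Lemma 4.7): the diagonal `⟨n⟩` has slice
rank exactly `n` (over a field). [cite: BlasiakChurchCohnGrochowNaslundSawinUmans2017, Lemma 4.7] -/
theorem sliceRank_unitTensor (n : ℕ) : sliceRank (Literature.Computability.AlgebraicComplexity.unitTensor K n) = n := by
  refine le_antisymm (by simpa using sliceRank_le_card (Literature.Computability.AlgebraicComplexity.unitTensor K n)) ?_
  have h := (hasSliceRankLE_sliceRank (Literature.Computability.AlgebraicComplexity.unitTensor K n)).card_le_of_diagonal
    (fun x y z hne => by by_contra hc; exact hne (by simp [Literature.Computability.AlgebraicComplexity.unitTensor_apply, hc]))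
    (fun x => by simp)
  simpa using h

/-- **BCCGNSU 2017, Prop. 4.8 in slice-rank form**: a tricolored sum-free set of cardinality `|ι|`
in a finite abelian group `H` has `|ι| ≤ slice-rank(D_H)` (over any field `K`).
[cite: BlasiakChurchCohnGrochowNaslundSawinUmans2017, Prop. 4.8] -/
theorem card_le_sliceRank_of_isTricoloredSumFree {H : Type u} [AddCommGroup H] [Fintype H]
    [DecidableEq H] {ι : Type*} [Fintype ι] {s t u : ι → H} (h : IsTricoloredSumFree s t u) :
    Fintype.card ι ≤ sliceRank (addGroupTensor K H) :=
  h.card_le (hasSliceRankLE_sliceRank (K := K) (addGroupTensor K H))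

/-- Every diagonal restricting from `D_H` has size at most `|H|`:
`⟨n⟩ ≤ D_H ⟹ n = slice-rank ⟨n⟩ ≤ slice-rank D_H ≤ |H|` (Tao's lemma, monotonicity, (4.2)).
[cite: BlasiakChurchCohnGrochowNaslundSawinUmans2017, Lemma 4.7 and (4.2)] -/
theorem le_card_of_tensorRestrictsTo_unitTensor {H : Type u} [AddCommGroup H] [Fintype H]
    [DecidableEq H] {n : ℕ} (h : Literature.Computability.AlgebraicComplexity.TensorRestrictsTo (addGroupTensor K H) (Literature.Computability.AlgebraicComplexity.unitTensor K n)) :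
    n ≤ Fintype.card H := by
  have h1 := sliceRank_le_of_tensorRestrictsTo h
  rw [sliceRank_unitTensor] at h1
  exact h1.trans (sliceRank_le_card _)

/-- Hence a tricolored sum-free set of cardinality `m` in a finite abelian group `H` shows
`Q(D_H) ≥ m` for the subrank `Q` (`subrank`: the largest diagonal restricting from `D_H`; the
defining set is bounded by `|H|` by `le_card_of_tensorRestrictsTo_unitTensor`).
[cite: BlasiakChurchCohnGrochowNaslundSawinUmans2017, Prop. 4.8 (proof)] -/
theorem le_subrank_of_isTricoloredSumFree {H : Type u} [AddCommGroup H] [Fintype H]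
    [DecidableEq H] {m : ℕ} {s t u : Fin m → H} (h : IsTricoloredSumFree s t u) :
    m ≤ Literature.Computability.AlgebraicComplexity.subrank K (addGroupTensor K H) :=
  le_csSup ⟨Fintype.card H, fun _ hn => le_card_of_tensorRestrictsTo_unitTensor hn⟩
    (tensorRestrictsTo_unitTensor_of_isTricoloredSumFree h)

end Bridge

/-! ## The packing bound is necessary (BCCGNSU 2017, Lemma 2.4 = BCCGU 2017, Thm. 2.8) — proved -/

section Packing

/-- For `p ≥ 1` and nonnegative reals, `∑ yᵢ^p ≤ (∑ yᵢ)^p` (super-additivity of `y ↦ y^p`).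
[folklore] -/
theorem sum_rpow_le_rpow_sum {ι : Type*} (S : Finset ι) (y : ι → ℝ) (hy : ∀ i ∈ S, 0 ≤ y i)
    {p : ℝ} (hp : 1 ≤ p) : ∑ i ∈ S, y i ^ p ≤ (∑ i ∈ S, y i) ^ p := by
  have hsum : 0 ≤ ∑ i ∈ S, y i := Finset.sum_nonneg hy
  have key : ∀ i ∈ S, y i ^ p ≤ y i * (∑ j ∈ S, y j) ^ (p - 1) := by
    intro i hi
    have hle : y i ≤ ∑ j ∈ S, y j := Finset.single_le_sum hy hi
    calc y i ^ p = y i ^ (1 + (p - 1)) := by ring_nf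
      _ = y i * y i ^ (p - 1) := by
          rcases (hy i hi).lt_or_eq with hpos | hzero
          · rw [Real.rpow_add hpos, Real.rpow_one]
          · rw [← hzero, Real.zero_rpow (by linarith), zero_mul]
      _ ≤ y i * (∑ j ∈ S, y j) ^ (p - 1) :=
          mul_le_mul_of_nonneg_left (Real.rpow_le_rpow (hy i hi) hle (by linarith)) (hy i hi)
  calc ∑ i ∈ S, y i ^ p ≤ ∑ i ∈ S, y i * (∑ j ∈ S, y j) ^ (p - 1) := Finset.sum_le_sum key
    _ = (∑ i ∈ S, y i) * (∑ j ∈ S, y j) ^ (p - 1) := by rw [Finset.sum_mul]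
    _ = (∑ i ∈ S, y i) ^ p := by
        rcases hsum.lt_or_eq with hpos | hzero
        · rw [← Real.rpow_one_add' hsum (by linarith), add_sub_cancel]
        · rw [← hzero, zero_mul, Real.zero_rpow (by linarith)]

/-- **BCCGNSU 2017, Lemma 2.4 — the printed chain of inequalities** (p. 5: "if
`∑ᵢ |Aᵢ||Bᵢ| ≤ |H|^{1−3ε}` for some fixed `ε > 0`, then `∑ᵢ (|Aᵢ||Bᵢ||Cᵢ|)^{ω/3} ≤ … ≤
(|H|^{1−ε})^{ω/2}`", using the packing bounds `∑ |Bᵢ||Cᵢ| ≤ |H|`, `∑ |Cᵢ||Aᵢ| ≤ |H|` and `ω ≥ 2`),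
for arbitrary nonnegative reals: if `∑ aᵢbᵢ ≤ h^{1−3ε}`, `∑ bᵢcᵢ ≤ h`, `∑ cᵢaᵢ ≤ h` (`h > 0`) and
`w ≥ 2`, then `∑ (aᵢbᵢcᵢ)^{w/3} ≤ (h^{1−ε})^{w/2}`. Proof as printed: power mean (`w/2 ≥ 1`), then
AM–GM on `aᵢbᵢh^{2ε} · bᵢcᵢh^{−ε} · cᵢaᵢh^{−ε}`.
[cite: BlasiakChurchCohnGrochowNaslundSawinUmans2017, Lemma 2.4 (proof)] -/
theorem sum_rpow_le_of_packing {ι : Type*} (S : Finset ι) (a b c : ι → ℝ)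
    (ha : ∀ i, 0 ≤ a i) (hb : ∀ i, 0 ≤ b i) (hc : ∀ i, 0 ≤ c i) {h ε w : ℝ} (hh : 0 < h)
    (hab : ∑ i ∈ S, a i * b i ≤ h ^ (1 - 3 * ε)) (hbc : ∑ i ∈ S, b i * c i ≤ h)
    (hca : ∑ i ∈ S, c i * a i ≤ h) (hw : 2 ≤ w) :
    ∑ i ∈ S, (a i * b i * c i) ^ (w / 3) ≤ (h ^ (1 - ε)) ^ (w / 2) := by
  -- step 1 (AM–GM): `(aᵢbᵢcᵢ)^{2/3} ≤ (aᵢbᵢ h^{2ε} + bᵢcᵢ h^{−ε} + cᵢaᵢ h^{−ε}) / 3`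
  have amgm : ∀ i ∈ S, (a i * b i * c i) ^ (2 / 3 : ℝ) ≤
      (a i * b i * h ^ (2 * ε) + b i * c i * h ^ (-ε) + c i * a i * h ^ (-ε)) / 3 := by
    intro i _
    have hp₁ : 0 ≤ a i * b i * h ^ (2 * ε) :=
      mul_nonneg (mul_nonneg (ha i) (hb i)) (Real.rpow_nonneg hh.le _)
    have hp₂ : 0 ≤ b i * c i * h ^ (-ε) :=
      mul_nonneg (mul_nonneg (hb i) (hc i)) (Real.rpow_nonneg hh.le _)
    have hp₃ : 0 ≤ c i * a i * h ^ (-ε) :=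
      mul_nonneg (mul_nonneg (hc i) (ha i)) (Real.rpow_nonneg hh.le _)
    have key := Real.geom_mean_le_arith_mean3_weighted (w₁ := 1/3) (w₂ := 1/3) (w₃ := 1/3)
      (by norm_num) (by norm_num) (by norm_num) hp₁ hp₂ hp₃ (by norm_num)
    have hprod : (a i * b i * h ^ (2 * ε)) ^ (1/3 : ℝ) * (b i * c i * h ^ (-ε)) ^ (1/3 : ℝ) *
        (c i * a i * h ^ (-ε)) ^ (1/3 : ℝ) = (a i * b i * c i) ^ (2 / 3 : ℝ) := by
      rw [← Real.mul_rpow hp₁ hp₂, ← Real.mul_rpow (mul_nonneg hp₁ hp₂) hp₃]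
      have hpow : a i * b i * h ^ (2 * ε) * (b i * c i * h ^ (-ε)) * (c i * a i * h ^ (-ε)) =
          (a i * b i * c i) ^ (2 : ℕ) := by
        have hexp : h ^ (2 * ε) * h ^ (-ε) * h ^ (-ε) = 1 := by
          rw [← Real.rpow_add hh, ← Real.rpow_add hh]
          ring_nf
          exact Real.rpow_zero h
        calc a i * b i * h ^ (2 * ε) * (b i * c i * h ^ (-ε)) * (c i * a i * h ^ (-ε))
            = (a i * b i * c i) ^ (2 : ℕ) * (h ^ (2 * ε) * h ^ (-ε) * h ^ (-ε)) := by ring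
          _ = (a i * b i * c i) ^ (2 : ℕ) := by rw [hexp, mul_one]
      rw [hpow, ← Real.rpow_natCast, ← Real.rpow_mul (mul_nonneg (mul_nonneg (ha i) (hb i)) (hc i))]
      norm_num
    rw [hprod] at key
    linarith
  -- step 2: sum and use the three packing-type hypotheses
  have hpow_pos : ∀ r : ℝ, 0 < h ^ r := fun r => Real.rpow_pos_of_pos hh r
  have step2 : ∑ i ∈ S, (a i * b i * c i) ^ (2 / 3 : ℝ) ≤ h ^ (1 - ε) := by
    calc ∑ i ∈ S, (a i * b i * c i) ^ (2 / 3 : ℝ)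
        ≤ ∑ i ∈ S, (a i * b i * h ^ (2 * ε) + b i * c i * h ^ (-ε) + c i * a i * h ^ (-ε)) / 3 :=
          Finset.sum_le_sum amgm
      _ = ((∑ i ∈ S, a i * b i) * h ^ (2 * ε) + (∑ i ∈ S, b i * c i) * h ^ (-ε) +
            (∑ i ∈ S, c i * a i) * h ^ (-ε)) / 3 := by
          rw [← Finset.sum_div, Finset.sum_add_distrib, Finset.sum_add_distrib, Finset.sum_mul,
            Finset.sum_mul, Finset.sum_mul]
      _ ≤ (h ^ (1 - 3 * ε) * h ^ (2 * ε) + h * h ^ (-ε) + h * h ^ (-ε)) / 3 := by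
          gcongr
      _ = h ^ (1 - ε) := by
          rw [← Real.rpow_add hh]
          nth_rewrite 2 [← Real.rpow_one h]
          nth_rewrite 4 [← Real.rpow_one h]
          rw [← Real.rpow_add hh]
          ring_nf
  -- step 3: power mean with exponent `w/2 ≥ 1`
  have hw2 : 1 ≤ w / 2 := by linarith
  have habc : ∀ i, 0 ≤ a i * b i * c i := fun i => mul_nonneg (mul_nonneg (ha i) (hb i)) (hc i)
  calc ∑ i ∈ S, (a i * b i * c i) ^ (w / 3)
      = ∑ i ∈ S, ((a i * b i * c i) ^ (2 / 3 : ℝ)) ^ (w / 2) := by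
        refine Finset.sum_congr rfl fun i _ => ?_
        rw [← Real.rpow_mul (habc i)]
        ring_nf
    _ ≤ (∑ i ∈ S, (a i * b i * c i) ^ (2 / 3 : ℝ)) ^ (w / 2) :=
        sum_rpow_le_rpow_sum S _ (fun i _ => Real.rpow_nonneg (habc i) _) hw2
    _ ≤ (h ^ (1 - ε)) ^ (w / 2) :=
        Real.rpow_le_rpow (Finset.sum_nonneg fun i _ => Real.rpow_nonneg (habc i) _) step2
          (by linarith)

/-- In an additive abelian group the one-clause STPP is invariant under the cyclic shift
`(A, B, C) ↦ (B, C, A)` (read the defining relation with the indices `(i, j, k) ↦ (k, i, j)`).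
[folklore] -/
theorem _root_.Literature.Computability.AlgebraicComplexity.IsSTPP.rotate {H : Type*} [AddCommGroup H] {N : ℕ} {A B C : Fin N → Finset H}
    (h : Literature.Computability.AlgebraicComplexity.IsSTPP A B C) : Literature.Computability.AlgebraicComplexity.IsSTPP B C A := by
  intro i j k s hs s' hs' t ht t' ht' u hu u' hu' he
  have he' : (u' - u) + (s' - s) + (t' - t) = 0 := by rw [← he]; abel
  obtain ⟨h1, h2, h3, h4, h5⟩ := h k i j u hu u' hu' s hs s' hs' t ht t' ht' he'
  exact ⟨h2, (h1.trans h2).symm, h4, h5, h3⟩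

/-- The three packing bounds for a one-clause STPP family with nonempty sets in a finite abelian
group: `∑ |Aᵢ||Bᵢ| ≤ |H|`, `∑ |Bᵢ||Cᵢ| ≤ |H|`, `∑ |Cᵢ||Aᵢ| ≤ |H|` (BCCGNSU 2017, §2, display before
Def. 2.3), from the tree's `AddSimultaneousTPP.sum_card_mul_card_le` and cyclic symmetry.
[cite: BlasiakChurchCohnGrochowNaslundSawinUmans2017, §2 (packing bounds)] -/
theorem _root_.Literature.Computability.AlgebraicComplexity.IsSTPP.packing {H : Type*} [AddCommGroup H] [Fintype H] [DecidableEq H] {N : ℕ}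
    {A B C : Fin N → Finset H} (h : Literature.Computability.AlgebraicComplexity.IsSTPP A B C) (hA : ∀ i, (A i).Nonempty)
    (hB : ∀ i, (B i).Nonempty) (hC : ∀ i, (C i).Nonempty) :
    ∑ i, (A i).card * (B i).card ≤ Fintype.card H ∧
      ∑ i, (B i).card * (C i).card ≤ Fintype.card H ∧
        ∑ i, (C i).card * (A i).card ≤ Fintype.card H := by
  have key : ∀ {A B C : Fin N → Finset H}, Literature.Computability.AlgebraicComplexity.IsSTPP A B C → (∀ i, (C i).Nonempty) →
      ∑ i, (A i).card * (B i).card ≤ Fintype.card H := fun h hC =>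
    ((Literature.Combinatorics.Additive.addSimultaneousTPP_iff_forall _ _ _).2 h).sum_card_mul_card_le hC
  exact ⟨key h hC, key h.rotate hA, key h.rotate.rotate hB⟩

/-- **BCCGNSU 2017, Lemma 2.4, effective form** ("Any family of STPP constructions that does not
meet the packing bound cannot imply `ω = 2` via the inequality (1.1)"; the proof shows "the
strongest bound that can be obtained from (1.1) is `ω ≤ 2 · 1/(1−ε)`"): if an STPP construction
with nonempty sets in a finite abelian group has `∑ᵢ |Aᵢ||Bᵢ| ≤ |H|^{1−3ε}` with `0 ≤ ε < 1`, then
`∑ᵢ (|Aᵢ||Bᵢ||Cᵢ|)^{τ/3} ≤ |H|` already holds at `τ = 2/(1−ε) ≥ 2` (`> 2` for `ε > 0`), so (1.1) —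
which is this inequality at `τ = ω` — cannot certify any `ω < 2/(1−ε)` from it (same for the two
other packing sums by symmetry). [cite: BlasiakChurchCohnGrochowNaslundSawinUmans2017, Lemma 2.4] -/
theorem _root_.Literature.Computability.AlgebraicComplexity.IsSTPP.sum_rpow_le_card_of_packing_defect {H : Type*} [AddCommGroup H] [Fintype H]
    [DecidableEq H] {N : ℕ} {A B C : Fin N → Finset H} (h : Literature.Computability.AlgebraicComplexity.IsSTPP A B C)
    (hA : ∀ i, (A i).Nonempty) (hB : ∀ i, (B i).Nonempty) (hC : ∀ i, (C i).Nonempty)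
    {ε : ℝ} (hε0 : 0 ≤ ε) (hε : ε < 1)
    (hdef : (∑ i, (((A i).card * (B i).card : ℕ) : ℝ)) ≤ (Fintype.card H : ℝ) ^ (1 - 3 * ε)) :
    ∑ i, (((A i).card * (B i).card * (C i).card : ℕ) : ℝ) ^ ((2 / (1 - ε)) / 3) ≤
      (Fintype.card H : ℝ) := by
  obtain ⟨-, hBC, hCA⟩ := h.packing hA hB hC
  have hcard : (0 : ℝ) < Fintype.card H := Nat.cast_pos.2 Fintype.card_pos
  have h1ε : (0 : ℝ) < 1 - ε := by linarith
  have hw : (2 : ℝ) ≤ 2 / (1 - ε) := by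
    rw [le_div_iff₀ h1ε]; nlinarith
  have main := sum_rpow_le_of_packing Finset.univ (fun i => ((A i).card : ℝ))
    (fun i => ((B i).card : ℝ)) (fun i => ((C i).card : ℝ)) (fun i => by positivity)
    (fun i => by positivity) (fun i => by positivity) hcard (ε := ε) (w := 2 / (1 - ε))
    (by simpa [Nat.cast_mul] using hdef) (by exact_mod_cast hBC) (by exact_mod_cast hCA) hw
  have hexp : ((Fintype.card H : ℝ) ^ (1 - ε)) ^ (2 / (1 - ε) / 2) = Fintype.card H := by
    rw [← Real.rpow_mul hcard.le]
    have hne : (1 - ε) ≠ 0 := h1ε.ne'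
    have : (1 - ε) * (2 / (1 - ε) / 2) = 1 := by field_simp
    rw [this, Real.rpow_one]
  rw [hexp] at main
  convert main using 2 with i
  push_cast
  ring_nf

end Packing

/-! ## The constants `ε`, `δ` and the rate function `J` (BCCGNSU 2017, Thm. A / A′, eq. (4.10)) -/

section Constants

/-- `δ = log((2/3)·2^{2/3}) = 0.05663…`, the constant of Thm. A′ (equal to `I(1, 1/3)` and to
`−log J(2)`, BCCGNSU 2017, proof of Thm. A′).
[cite: BlasiakChurchCohnGrochowNaslundSawinUmans2017, Thm. A′] -/
def bccgnsuDelta : ℝ := Real.log (2 / 3 * (2 : ℝ) ^ (2 / 3 : ℝ))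

/-- `ε = δ/2 = ½ log((2/3)·2^{2/3}) = 0.02831…`, the constant of Thm. A.
[cite: BlasiakChurchCohnGrochowNaslundSawinUmans2017, Thm. A] -/
def bccgnsuEpsilon : ℝ := bccgnsuDelta / 2

/-- `δ > 0`, i.e. `(2/3)·2^{2/3} > 1` (cube: `4 > 27/8`). [folklore] -/
theorem bccgnsuDelta_pos : 0 < bccgnsuDelta := by
  unfold bccgnsuDelta
  refine Real.log_pos ?_
  have h2 : (3 / 2 : ℝ) < (2 : ℝ) ^ (2 / 3 : ℝ) := by
    have hcube : ((2 : ℝ) ^ (2 / 3 : ℝ)) ^ (3 : ℕ) = 4 := by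
      rw [← Real.rpow_natCast, ← Real.rpow_mul (by norm_num)]; norm_num
    refine lt_of_pow_lt_pow_left₀ 3 (Real.rpow_nonneg (by norm_num) _) ?_
    rw [hcube]; norm_num
  linarith

/-- `ε > 0`. [folklore] -/
theorem bccgnsuEpsilon_pos : 0 < bccgnsuEpsilon := half_pos bccgnsuDelta_pos

/-- The rate function **`J(s)`** of BCCGNSU 2017, eq. (4.10):
`J(s) = e^{−I(s−1, 1/3)} = (1/s) · inf_{0<x<1} (1 − x^s)/(1 − x) · x^{−(s−1)/3}` (`s > 1`), with the
geometric sum `∑_{i<s} xⁱ` written for `(1 − x^s)/(1 − x)`. For a prime power `q`,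
`3 (q J(q))ⁿ` bounds the slice rank of `D_{(ℤ/qℤ)ⁿ}` in characteristic `p` (proof of Thm. 4.14);
`J` is decreasing, `J(s) < 1`, `lim J(s) = 0.8414…` (Prop. 4.12, (4.11)).
[cite: BlasiakChurchCohnGrochowNaslundSawinUmans2017, (4.10)] -/
def bccgnsuJ (s : ℕ) : ℝ :=
  sInf ((fun x : ℝ => (∑ i ∈ Finset.range s, x ^ i) * x ^ (-(((s : ℝ) - 1) / 3))) ''
    Set.Ioo (0 : ℝ) 1) / s

/-- Every `x ∈ (0,1)` gives an upper bound `J(s) ≤ (∑_{i<s} xⁱ) x^{−(s−1)/3} / s`. [folklore] -/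
theorem bccgnsuJ_le {s : ℕ} {x : ℝ} (hx0 : 0 < x) (hx1 : x < 1) :
    bccgnsuJ s ≤ (∑ i ∈ Finset.range s, x ^ i) * x ^ (-(((s : ℝ) - 1) / 3)) / s := by
  unfold bccgnsuJ
  refine div_le_div_of_nonneg_right (csInf_le ⟨0, ?_⟩ ⟨x, ⟨hx0, hx1⟩, rfl⟩) (Nat.cast_nonneg s)
  rintro _ ⟨y, ⟨hy0, _⟩, rfl⟩
  exact mul_nonneg (Finset.sum_nonneg fun i _ => pow_nonneg hy0.le i) (Real.rpow_nonneg hy0.le _)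

/-- `J(s) ≥ 0`. [folklore] -/
theorem bccgnsuJ_nonneg (s : ℕ) : 0 ≤ bccgnsuJ s := by
  unfold bccgnsuJ
  refine div_nonneg (Real.sInf_nonneg ?_) (Nat.cast_nonneg s)
  rintro _ ⟨y, ⟨hy0, _⟩, rfl⟩
  exact mul_nonneg (Finset.sum_nonneg fun i _ => pow_nonneg hy0.le i) (Real.rpow_nonneg hy0.le _)

end Constants

/-! ## Named facts: Thm. 4.14, Thm. A′, Thm. A (statements only) -/

section Facts

open Literature.Combinatorics.Additive

/-- **BCCGNSU 2017, Theorem 4.14** (p. 22: "If `H` is an abelian group `H ≅ (ℤ/qℤ)ⁿ × G` where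
`q` is a prime power, then every tricolored sum-free set in `H` has cardinality at most
`3 · |H| · J(q)ⁿ`"). The sharp slice-rank bound behind Thm. A and A′ ("known to be sharp up to a
subexponential factor by [KSS, Thm. 2]" with [Norin], [Pebody]). `G` is an arbitrary (finite)
abelian group, the tricolored sum-free set is indexed by a finite type `ι` (`|M| = |ι|`).
[cite: BlasiakChurchCohnGrochowNaslundSawinUmans2017, Thm. 4.14] -/
def BCCGNSU2017_thm414 : Prop :=
  ∀ (q n : ℕ), IsPrimePow q → ∀ (G : Type) [AddCommGroup G] (H : Type) [AddCommGroup H]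
    [Fintype H], Nonempty (H ≃+ ((Fin n → ZMod q) × G)) →
    ∀ (ι : Type) [Fintype ι] (s t u : ι → H), IsTricoloredSumFree s t u →
      (Fintype.card ι : ℝ) ≤ 3 * Fintype.card H * bccgnsuJ q ^ n

/-- **BCCGNSU 2017, Theorem A′** (p. 2: "There exists an absolute constant
`δ = 2ε = 0.05663…` such that if `H ≅ (ℤ/qℤ)ⁿ` for some prime power `q`, then every tricolored
sum-free set in `H` has size at most `3 · |H|^{1 − δ/log q}`"), with the printed value
`δ = log((2/3)2^{2/3})` (`bccgnsuDelta`; natural logarithm, as in the proof: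
`J(q) ≤ J(2) = e^{−δ} = q^{−δ/log q}`). [cite: BlasiakChurchCohnGrochowNaslundSawinUmans2017, Thm. A′] -/
def BCCGNSU2017_thmA' : Prop :=
  ∀ (q n : ℕ), IsPrimePow q → ∀ (H : Type) [AddCommGroup H] [Fintype H],
    Nonempty (H ≃+ (Fin n → ZMod q)) →
    ∀ (ι : Type) [Fintype ι] (s t u : ι → H), IsTricoloredSumFree s t u →
      (Fintype.card ι : ℝ) ≤ 3 * (Fintype.card H : ℝ) ^ (1 - bccgnsuDelta / Real.log q)

/-- **BCCGNSU 2017, Theorem A** (p. 2: "There exists an absolute constant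
`ε = ½ log((2/3)2^{2/3}) = 0.02831…` such that if `H` is an abelian group generated by elements of
order at most `m`, then every tricolored sum-free set in `H` has size at most `3 · |H|^{1 − ε/m}`").
`H` finite abelian; "generated by elements of order at most `m`" is
`AddSubgroup.closure {h | addOrderOf h ≤ m} = ⊤` (implied by exponent `≤ m`,
`BCCGNSU2017_thmA.of_exponent_le`). This disproves the strong USP conjecture of CKSU 2005 (via
Alon–Shpilka–Umans) and, through Thm. 3.3 / Lemma 3.4 / Lemma 3.5 / Lemma 2.4, gives Thm. B.
[cite: BlasiakChurchCohnGrochowNaslundSawinUmans2017, Thm. A] -/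
def BCCGNSU2017_thmA : Prop :=
  ∀ (H : Type) [AddCommGroup H] [Fintype H] (m : ℕ),
    AddSubgroup.closure {h : H | addOrderOf h ≤ m} = ⊤ →
    ∀ (ι : Type) [Fintype ι] (s t u : ι → H), IsTricoloredSumFree s t u →
      (Fintype.card ι : ℝ) ≤ 3 * (Fintype.card H : ℝ) ^ (1 - bccgnsuEpsilon / m)

/-- Thm. A for groups of exponent at most `m` (every element then has order `≤ m`, so `H` is
generated by elements of order at most `m`) — the hypothesis of Thm. B.
[cite: BlasiakChurchCohnGrochowNaslundSawinUmans2017, Thm. A and §3.2] -/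
theorem BCCGNSU2017_thmA.of_exponent_le (hA : BCCGNSU2017_thmA) (H : Type) [AddCommGroup H]
    [Fintype H] {m : ℕ} (hm : AddMonoid.exponent H ≤ m) (ι : Type) [Fintype ι] (s t u : ι → H)
    (h : IsTricoloredSumFree s t u) :
    (Fintype.card ι : ℝ) ≤ 3 * (Fintype.card H : ℝ) ^ (1 - bccgnsuEpsilon / m) := by
  refine hA H m ?_ ι s t u h
  have hall : {g : H | addOrderOf g ≤ m} = Set.univ := by
    refine Set.eq_univ_of_forall fun g => ?_
    have hdvd := AddMonoid.addOrder_dvd_exponent g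
    exact (Nat.le_of_dvd (Nat.pos_of_ne_zero AddMonoid.exponent_ne_zero_of_finite) hdvd).trans hm
  rw [hall]
  exact AddSubgroup.closure_univ

/-- Thm. A′ in product form: for `H ≅ (ℤ/qℤ)ⁿ`, `|H|^{1 − δ/log q} = (q e^{−δ})ⁿ`, so a tricolored
sum-free set has size at most `3 (q e^{−δ})ⁿ` — exponentially smaller than `|H| = qⁿ`.
[cite: BlasiakChurchCohnGrochowNaslundSawinUmans2017, Thm. A′ (proof)] -/
theorem BCCGNSU2017_thmA'.pow_form (hA : BCCGNSU2017_thmA') {q n : ℕ} (hq : IsPrimePow q)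
    (H : Type) [AddCommGroup H] [Fintype H] (e : H ≃+ (Fin n → ZMod q)) (ι : Type) [Fintype ι]
    (s t u : ι → H) (h : IsTricoloredSumFree s t u) :
    (Fintype.card ι : ℝ) ≤ 3 * ((q : ℝ) * Real.exp (-bccgnsuDelta)) ^ n := by
  have hq1 : 1 < q := hq.one_lt
  haveI : NeZero q := ⟨by omega⟩
  have hcard : Fintype.card H = q ^ n := by
    rw [Fintype.card_congr e.toEquiv, Fintype.card_pi, Finset.prod_const, ZMod.card,
      Finset.card_univ, Fintype.card_fin]
  have hmain := hA q n hq H ⟨e⟩ ι s t u h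
  rw [hcard] at hmain
  have hq0 : (0 : ℝ) < q := by exact_mod_cast (zero_lt_one.trans hq1)
  have hlog : Real.log q ≠ 0 := Real.log_ne_zero_of_pos_of_ne_one hq0 (by exact_mod_cast hq1.ne')
  have eq1 : (((q ^ n : ℕ) : ℝ)) ^ (1 - bccgnsuDelta / Real.log q) =
      (q : ℝ) ^ n * Real.exp (-(bccgnsuDelta * n)) := by
    push_cast
    rw [← Real.rpow_natCast (q : ℝ) n, ← Real.rpow_mul hq0.le, mul_sub, mul_one, sub_eq_add_neg,
      Real.rpow_add hq0]
    congr 1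
    rw [Real.rpow_def_of_pos hq0]
    congr 1
    field_simp
  have eq2 : ((q : ℝ) * Real.exp (-bccgnsuDelta)) ^ n = (q : ℝ) ^ n * Real.exp (-(bccgnsuDelta * n)) := by
    rw [mul_pow, ← Real.exp_nat_mul]
    congr 1
    congr 1
    ring
  rw [eq2, ← eq1]
  exact hmain


end Facts

/-! ## Catalogue entry (D-0021) -/

section Catalogue

/-- **Tricolored sum-free sets are exponentially small in abelian groups of bounded exponent, so
STPP constructions there cannot give `ω = 2` (Blasiak–Church–Cohn–Grochow–Naslund–Sawin–Umans
2017).** The catalogue entry is the conjunction Thm. A ∧ Thm. A′ ∧ Thm. 4.14 ∧ Thm. B (the last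
being the tree's `BlasiakChurchCohnGrochowNaslundSawinUmans2017_B`).

BARRIER
technique_class: group-theoretic-approach, Cohn–Umans, Cohn–Kleinberg–Szegedy–Umans, simultaneous-triple-product-property (`IsSTPP` / `SimultaneousTPP`) — each ONLY within the sub-class STPP-constructions-in-ABELIAN-groups-of-BOUNDED-exponent (families `(Aᵢ,Bᵢ,Cᵢ)` in finite abelian `H` with `exponent H ≤ ℓ`, bound on `ω` read off the fundamental inequality `∑ᵢ(|Aᵢ||Bᵢ||Cᵢ|)^{ω/3} ≤ |H|` = CKSU Thm. 5.5 / BCCGNSU (1.1)); strong-USP-conjecture (CKSU Conj. 3.4, host `𝔽₃ⁿ`); STPP/USP simulations of Coppersmith–Winograd-type constructions in `(ℤ/mℤ)ⁿ` with `m` fixed (CKSU 2005 §3, §6: `ω < 2.48`, `ω < 2.41`). NOT in the class (audit 2026-08-15): the laser method on `CW_q` itself (→ `UniversalMethodBarrier`, `IrreversibilityBarrier`), non-abelian hosts (→ `NilpotentGroupBarrier`, `YoungSubgroupBarrier`, `QuasirandomBarrier`, `NormalizerBarrier`), abelian hosts of growing exponent (no barrier known), and the slice-rank / polynomial method, which is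 this obstruction's TOOL (see `because`), not a blocked technique
blocks: certifying `MatrixMultiplication` (`ω = 2`) through the route thesis `CThesis` of `MatrixMultiplication/GroupTheoreticSTPP` restricted to abelian groups of BOUNDED exponent: "For every `ℓ ∈ ℕ`, there is an `ε_ℓ > 0` such that no STPP construction in any abelian group of exponent at most `ℓ` is large enough to yield a bound better than `ω ≤ 2 + ε_ℓ` via the inequality (1.1)" (`BlasiakChurchCohnGrochowNaslundSawinUmans2017_B`) [cite: BlasiakChurchCohnGrochowNaslundSawinUmans2017, Thm. B]; in particular the strong USP conjecture of CKSU 2005 (Conj. 3.4, which would give `ω = 2` in `𝔽₃ⁿ`) is false [cite: BlasiakChurchCohnGrochowNaslundSawinUmans2017, Thm. A and §1 (p. 2)], and "all of the current best bounds on `ω` via the group-theoretic approach (in [CKSU]), as well as the current best bounds on `ω` which use the Coppersmith–Winograd approach, yield STPP constructions whose underlying group is `(ℤ/mℤ)ⁿ` for `m` fixed" [cite: BlasiakChurchCohnGrochowNaslundSawinUmans2017, §1 (p. 3)] (printed without reference: CKSU 2005 derive `ω < 2.48` and `ω < 2.41` from strong / local USPs as STPP constructions and announce that "the bound `ω < 2.376`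 from [CW] may be derived … see the full version of this paper", which did not appear; the later laser analyses are not documented as STPP constructions — immaterial to Thm. B, which covers whatever STPP constructions exist) [cite: CohnKleinbergSzegedyUmans2005, §3 and §6 (closing remark of §6)]; QUANTITATIVELY (tree, `TricoloredSumFreeBarrierEffective.lean`; not in print): no STPP construction in an abelian group of exponent `≤ ℓ` certifies `ω < 2 + 3ε/ℓ = 2 + 0.08494…/ℓ` via (1.1) (`BCCGNSU2017_thmB_explicit`, from Thm. A), and none in an elementary abelian `p`-group certifies `ω < 2 + 3c_p`, `c_p = −log J(p)/log p` the Fox–Lovász exponent (`BCCGNSU2017_thmB_elementary`, from Thm. 4.14): `2 + 3c_p = 2.2451 (p = 2), 2.2325 (3), 2.2124 (5), 2.1980 (7), 2.1790 (11), 2.1722 (13), 2.1100 (101)`, `3c_p ∼ 0.518/log p → 0` [cite: BlasiakChurchCohnGrochowNaslundSawinUmans2017, Thm. B and Thm. 4.14]; necessary condition in ANY group: a family of STPP constructions that does not meet the packing bound `∑|Aᵢ||Bᵢ| ≥ |H|^{1−o(1)}` (and cyclically) cannot imply `ω = 2` via (1.1) (`IsSTPP.sum_rpow_le_card_of_packing_defect`,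 proved) [cite: BlasiakChurchCohnGrochowNaslundSawinUmans2017, Lemma 2.4].
because: (i) an STPP construction in abelian `H` yields a border tricolored sum-free set of size `≥ ∑ᵢ |Aᵢ||Bᵢ||Cᵢ|/(|Aᵢ|+|Bᵢ|+|Cᵢ|)` (Thm. 3.3 — PROVED in the tree: `AddSimultaneousTPP.exists_isBorderTricoloredSumFree`, `BorderTricoloredSumFree.lean`), which becomes a genuine tricolored sum-free set of size `|M|^{(1−o(1))N}` in `H^N` (Lemma 3.4 — PROVED: `IsBorderTricoloredSumFree.exists_isTricoloredSumFree_pi`), and a family proving `ω ≤ 2 + δ` for all `δ > 0` meets the packing bound (Lemma 2.4) and can be made uniform in powers (Lemma 3.5), so it would produce tricolored sum-free sets of size `|H^N|^{1−o(1)}` in groups of the same exponent `≤ ℓ` (§3.2) [cite: BlasiakChurchCohnGrochowNaslundSawinUmans2017, §3]; (ii) but a tricolored sum-free set of size `m` makes `D_H|_{S×T×U}` a diagonal, so `m ≤ slice-rank(D_H)` (Tao's Lemma 4.7, Prop. 4.8 — `card_le_sliceRank_of_isTricoloredSumFree`, proved) [cite: BlasiakChurchCohnGrochowNaslundSawinUmans2017,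 Prop. 4.8], while in characteristic `p` the triangle rank of `D_{ℤ/qℤ}` is `≤ q` (Lucas' theorem, Prop. 4.15 — PROVED in the tree: `shiftedIndicator_eq_sum`), whence `slice-rank(D_{(ℤ/qℤ)ⁿ×G}) ≤ 3(qJ(q))ⁿ|G|` by a Hoeffding/Cramér count of low-weight monomials and `slice-rank(F ⊗ G) ≤ slice-rank(F)·|side of G|` (Prop. 4.13, Prop. 4.2, Thm. 4.14 — PROVED in counting form with crude constants: `hasSliceRankLE_piZMod`, `HasSliceRankLE.mul_tensor`, `IsTricoloredSumFree.card_le_of_addEquiv`, `card_lowWeight_mul_pow_le`, `TricoloredSumFreeBound.lean`), giving `|M| ≤ 3|H|^{1−δ/log q}` for `H ≅ (ℤ/qℤ)ⁿ` and `|M| ≤ 3|H|^{1−ε/m}` for `H` generated by elements of order `≤ m` (CRT + a prime-power count, Thm. A′, Thm. A; the qualitative `∃ δ_ℓ > 0` form of Thm. A is PROVED: `Literature.Combinatorics.Additive.exists_tricoloredSumFree_card_le`) [cite: BlasiakChurchCohnGrochowNaslundSawinUmans2017, §4.3–4.4].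
evasions_known: (a) abelian groups with a large cyclic factor / unbounded exponent: "when the group has a large cyclic factor, it indeed contains a large sum-free subset and thus the constraints analyzed here are irrelevant" [cite: BlasiakChurchCohnGrochowNaslundSawinUmans2017, §1 (p. 3)] — indeed `slice-rank(M_{ℤ/nℤ}) = n` in every characteristic, so the slice-rank method proves nothing for cyclic groups [cite: BlasiakChurchCohnGrochowUmans2017, Thm. B.8], and CKSU's "two families" conjecture (Conj. 4.7) lives in groups that "need not have bounded exponent" [cite: BlasiakChurchCohnGrochowNaslundSawinUmans2017, §2 (p. 5)] (route items `CPackingConstruction`, `CThesis`); (b) non-abelian groups "or even more general objects such as association schemes" (Cohn–Umans 2013) [cite: BlasiakChurchCohnGrochowNaslundSawinUmans2017, §1 (p. 3)] — partially closed since: nilpotent groups of bounded exponent with bounded-variance or linear-expectation `p`-degrees, and Young-subgroup TPP constructions in `Sₙ` [cite: BlasiakChurchCohnGrochowUmans2017, Thm. 3.19 and Thm. 4.2], groups of Lie type and subgroups with large normalisers [cite: BlasiakCohnGrochowPrattUmans2023, Cor. 3.4 and Thm. 3.6]; (c) the bound of Thm. 4.14 is sharp up to subexponential factors (Kleinberg–Sawin–Speyer,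 Norin, Pebody), so within bounded exponent no better constructions of tricolored sum-free sets can rescue the method, but equally the slice-rank method cannot be pushed below `(qJ(q))ⁿ` [cite: BlasiakChurchCohnGrochowNaslundSawinUmans2017, Thm. 4.14 (remark following)]; (d) sequences of groups and infinite groups: for every FIXED finite group `G`, abelian or not, even the Galactic method (monomial degenerations of powers of `T_G`, subsuming STPP zeroing-outs in `Gⁿ`) has `ω_g(T_G) > 2`, but "it does not rule out showing `ω = 2` by using a sequence `G₁, G₂, …` of groups" [cite: AlmanVassilevskaWilliams2018, Thm. 6.1 and Rem. 6.1] — Thm. B is exactly the result that does cover all sequences inside ONE bounded-exponent abelian class — and the framework has since been extended to infinite (Lie) groups, with "constructions in Lie groups, with favorable parameters, that are provably impossible in finite groups of Lie type", where no slice-rank barrier is formulated [cite: BlasiakCohnGrochowPrattUmans2025, §1]; (e) quantitative head-room (audit 2026-08-15): every explicit value of the barrier (`blocks`) is `< 2.3714`, the current record, so Thm. B excludes `ω = 2` — indeed `ω < 2 + 3c_p`, e.g. `ω < 2.2451` from `𝔽₂ⁿ`-hosts — but does NOT exclude improving the record on `ω` by STPP constructions in abelian groups of any fixed exponent, not even `2`;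 the best printed STPP/USP-certified bounds are `2.48` / `2.41` [cite: CohnKleinbergSzegedyUmans2005, §3 and §6], and the range between `2 + 3c_p` and them is unexplored.
scope_caveats: (a) Thm. B is about bounds obtained "via the inequality (1.1)" from STPP constructions in abelian groups of exponent `≤ ℓ`, with `ε_ℓ` depending on `ℓ` (the proof gives no uniform `ε`); it says nothing about abelian groups of growing exponent (the route's negative crux `CAbelianObstructionNeg`, Thm. B with a uniform `ε` for ALL finite abelian groups, is OPEN and is not this theorem), nothing about non-abelian groups, and nothing about uses of group algebras beyond (1.1) [cite: BlasiakChurchCohnGrochowNaslundSawinUmans2017, Thm. B and §1 (p. 3)]; (b) "our results serve to focus the search for group-theoretic constructions, and certainly do not rule them out as an approach to achieving `ω = 2`" [cite: BlasiakChurchCohnGrochowNaslundSawinUmans2017, §1 (p. 3)]; (c) formal status (updated at the 2026-08-15 audit): the WHOLE entry is proved in the tree, sorry-free with axioms `{propext, Classical.choice, Quot.sound}` — `TricoloredSumFreeBarrier_holds` (`TricoloredSumFreeBarrierProofs.lean`: `BCCGNSU2017_thm414_holds`, `BCCGNSU2017_thmA'_holds`, `BCCGNSU2017_thmA_holds` with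 the printed constants, Bonferroni/Chebyshev bookkeeping replacing the calculus and Rosser–Schoenfeld steps) and `BlasiakChurchCohnGrochowNaslundSawinUmans2017_B_holds` (`GroupTheoreticMatMulThmBProofs.lean`, the §3.2 argument made effective: `ε = 3δ_ℓ`), on top of Thm. 3.3 / Lemma 3.4 (`BorderTricoloredSumFree.lean`), Lemma 4.7 / Prop. 4.8 (`SliceRankMethod.lean`), Props. 4.12–4.15 (`TricoloredSumFreeBound.lean`) and Lemma 2.4 (here); the statements in this file are unchanged named `def`s, now all inhabited [cite: BlasiakChurchCohnGrochowNaslundSawinUmans2017, §3–4]; (d) Thm. A is stated, as printed, for `H` generated by elements of order `≤ m` (weaker than exponent `≤ m`; the exponent is then `≤ lcm(1,…,m) = e^{m(1+o(1))}`) [cite: BlasiakChurchCohnGrochowNaslundSawinUmans2017, §1 (p. 2)]; (e) Thm. B is printed as `∃ ε_ℓ > 0` and proved by contradiction with `o(1)`'s (§3.2); no value of `ε_ℓ` is printed there, nor in Blasiak–Church–Cohn–Grochow–Umans 2017 (Thm. 2.9 / Cor. 2.11: "`|G|^{1−Ω(1)}`") or Alman–Vassilevska Williams 2018 (Thm. 6.1: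 "`ω_g(T_G) > 2`"), and Christandl–Vrana–Zuiddam, whose monomial-irreversibility barrier covers `⟨G⟩` for "any fixed nontrivial group `G`", state "We have not tried to numerically optimise the monomial irreversibility barriers for group algebras" [cite: ChristandlVranaZuiddam2021, §4.3 ("Monomial irreversibility of structure tensors of finite group algebras")]; the explicit values quoted in `blocks` are the tree's (`TricoloredSumFreeBarrierEffective.lean`: `sum_rpow_le_card_of_tsf`, `BCCGNSU2017_thmB_explicit`, `BCCGNSU2017_thmB_elementary`) and are the limit of THIS argument — its tricolored-sum-free step is sharp (evasion (c)) and its only other inputs are Thm. 3.3's conversion `|M| ≥ Σᵢ|Aᵢ||Bᵢ||Cᵢ|/(|Aᵢ|+|Bᵢ|+|Cᵢ|)` and the abelian packing `|Aᵢ||Bᵢ||Cᵢ| ≤ |H|` (which is what lifts `2/(1−c_p)`, the universal-method value of the fixed tensor `D_{ℤ/p}` in characteristic `p` — `2.16805` at `p = 3` — to `2 + 3c_p`); whether STPP constructions come anywhere near `2 + 3c_p` is open [cite: BlasiakChurchCohnGrochowNaslundSawinUmans2017, §3.2] [cite: AlmanVassilevskaWilliams2018, Thm. 6.1]; (f) "a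 bound better than `ω ≤ 2 + ε` via (1.1)" is formalised as `|H| < Σᵢ(|Aᵢ||Bᵢ||Cᵢ|)^{(2+ε)/3}` (one exponent; equivalent by monotonicity in the exponent, `sum_rpow_mono` in the Effective file), over `IsSTPP` families indexed by `Fin N` (empty sets contribute `0`, so no nonemptiness hypothesis is needed) [cite: BlasiakChurchCohnGrochowNaslundSawinUmans2017, Thm. B].
status: theorem (established and formally PROVED: `TricoloredSumFreeBarrier_holds`; explicit `ε_ℓ` in `TricoloredSumFreeBarrierEffective.lean`; audit 2026-08-15: CONFIRMED, scope sharpened as in `technique_class` / `scope_caveats` (e)) [cite: BlasiakChurchCohnGrochowNaslundSawinUmans2017, Thm. A and Thm. B] -/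
def TricoloredSumFreeBarrier : Prop :=
  BCCGNSU2017_thmA ∧ BCCGNSU2017_thmA' ∧ BCCGNSU2017_thm414 ∧
    Literature.Computability.AlgebraicComplexity.BlasiakChurchCohnGrochowNaslundSawinUmans2017_B

/-- Projection: Thm. A. [cite: BlasiakChurchCohnGrochowNaslundSawinUmans2017, Thm. A] -/
theorem TricoloredSumFreeBarrier.thmA (h : TricoloredSumFreeBarrier) : BCCGNSU2017_thmA := h.1

/-- Projection: Thm. A′. [cite: BlasiakChurchCohnGrochowNaslundSawinUmans2017, Thm. A′] -/
theorem TricoloredSumFreeBarrier.thmA' (h : TricoloredSumFreeBarrier) : BCCGNSU2017_thmA' := h.2.1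

/-- Projection: Thm. 4.14. [cite: BlasiakChurchCohnGrochowNaslundSawinUmans2017, Thm. 4.14] -/
theorem TricoloredSumFreeBarrier.thm414 (h : TricoloredSumFreeBarrier) : BCCGNSU2017_thm414 :=
  h.2.2.1

/-- Projection: Thm. B (the tree's named fact).
[cite: BlasiakChurchCohnGrochowNaslundSawinUmans2017, Thm. B] -/
theorem TricoloredSumFreeBarrier.thmB (h : TricoloredSumFreeBarrier) :
    Literature.Computability.AlgebraicComplexity.BlasiakChurchCohnGrochowNaslundSawinUmans2017_B :=
  h.2.2.2

/-- **The barrier applied to the route**: under Thm. B, for every `ℓ` there is `ε > 0` such that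
no STPP construction in a finite abelian group of exponent `≤ ℓ` witnesses the route thesis
`CThesis` at this `ε` (i.e. beats `|H|` at exponent `(2+ε)/3`); so witnesses of `CThesis` for
`ε → 0` must live in groups of unbounded exponent.
[cite: BlasiakChurchCohnGrochowNaslundSawinUmans2017, Thm. B] -/
theorem TricoloredSumFreeBarrier.not_beats_of_exponent_le (h : TricoloredSumFreeBarrier) (ℓ : ℕ) :
    ∃ ε : ℝ, 0 < ε ∧ ∀ (H : Type) [AddCommGroup H] [Fintype H], AddMonoid.exponent H ≤ ℓ →
      ∀ (N : ℕ) (A B C : Fin N → Finset H), Literature.Computability.AlgebraicComplexity.IsSTPP A B C →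
        ¬ ((Fintype.card H : ℝ) <
            ∑ i, (((A i).card * (B i).card * (C i).card : ℕ) : ℝ) ^ ((2 + ε) / 3)) := by
  obtain ⟨ε, hε, hB⟩ := h.thmB ℓ
  exact ⟨ε, hε, fun H _ _ hexp N A B C hS hlt => lt_irrefl _ (hlt.trans_le (hB H hexp N A B C hS))⟩

end Catalogue

end Literature.Barriers.MatrixMultiplication
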